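import Literature.Topology.FourManifolds.HomotopySpheresBPOrderDischarge
import Literature.Topology.FourManifolds.HomotopySpheresBPSevenLeaves
import Literature.Topology.FourManifolds.HomotopySpheresStablyParallelizableSeven
import Literature.Topology.FourManifolds.HomotopySpheresBPOrderSignatureDischarge
import Literature.Topology.FourManifolds.HomotopySpheresSignatureConnectedSumHolds
import HarnessLib

/-!
# `|Θ₇| = 28`: the discharge file of `natCard_homotopySphereClass_seven` (spc4.S13)

Topic `Literature/Topology/FourManifolds`; pure-proof sibling of `HCobordism.lean`, the host of
the named fact `Literature.Topology.FourManifolds.natCard_homotopySphereClass_seven`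
(`Nat.card (HomotopySphereClass 7) = 28`: the oriented-diffeomorphism classes of smooth homotopy
`7`-spheres — Kervaire–Milnor's `Θ₇`, h-cobordism classes, the two quotients agreeing for
`n = 7 ≥ 5` by Smale — number `28`; Kervaire–Milnor, *Groups of homotopy spheres I*, Ann. of
Math. 77 (1963), Thm. 1.2 and the table p. 504, `Θ₇ : 28`; complete printed proof: Kosinski,
*Differential Manifolds* (1993), Ch. X §6, (6.6) and p. 219, "Since Coker `J₇ = 0`, …
`θ⁷ = ℤ₂₈`", with Prop. 6.2(a) and p. 217, "`bP⁸ = ℤ₂₈`"). This is the file in which the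
discharge `natCard_homotopySphereClass_seven_holds` is to land. Everything here is **proved**; no
definition, no named fact and no statement is added or changed (net debt `0`).

The fact is glue: `natCard_homotopySphereClass_seven_of_bP` (`HomotopySpheresBPOrder.lean`)
proves it from its two conjuncts, `Θ₇ = bP₈` (`HomotopySphere.boundsParallelizable_seven`,
Kervaire–Milnor §4, table p. 512) and `|bP₈| = 28` (`HomotopySphereClass.natCard_bP_seven`, §7,
pp. 530–531), and the tree reduces each conjunct to its deepest undischarged printed results
WITHOUT new named facts:

* `Θ₇ = bP₈` from **three** named facts (`HomotopySphere.boundsParallelizable_seven_of_leaves`,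
  `HomotopySpheresBPSevenLeaves.lean`): Bott's `π₆(SO(8)) = 0` in extension form
  (`Bott1959_sphereMapsToStableFramesExtend_six`, giving Thm. 3.1 at `n = 7`), Lemma 4.2 in the
  Pontryagin–Thom direction (`boundsParallelizable_of_collapseNullHomotopic`) and `0 ∈ p(Σ⁷)`
  (`HomotopySphere.exists_collapseNullHomotopic_seven`, Lemma 4.5 with `coker J₇ = 0`); Lemma 3.3
  and "`o₇` is the only obstruction" being theorems there. One rung lower, Bott's fact follows
  from `π₆(SO(7), 1) = 0`
  (`Bott1959_sphereMapsToStableFramesExtend_six_of_specialOrthogonalGroup_seven`,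
  `HomotopySpheresStablyParallelizableSeven.lean`).
* `|bP₈| = 28` from **eight** named facts (`HomotopySphereClass.natCard_bP_seven_of_frontier'`,
  `HomotopySpheresBPOrderDischarge.lean`): Thm. 7.5 (`HomotopySphere.mk_eq_mk_iff_sigmaGen_dvd_sub`),
  Kosinski's X.2.2/X.3.3 (`HomotopySphere.exists_highlyConnected_of_mem_signatureSet`) and X.3.1
  (`HomotopySphere.isEven_intersectionForm_closedModel`), Milnor's `E₈`-plumbing
  (`HomotopySphere.exists_intersectionForm_equivalent_e8Form`), Milnor's Prop. B
  (`nonempty_homeomorph_sphere_of_homologySphere_of_five_le`), additivity of `σ` over sums along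
  the boundary (`HomotopySphere.add_mem_signatureSet_of_isOrientedConnectedSum`) and the two halves
  of `σ₂ = 224` (`HomotopySphere.twoHundredTwentyFour_dvd_of_mem_signatureSet_sphere`,
  `HomotopySphere.exists_twoHundredTwentyFour_mem_signatureSet_sphere`); or, over the deepest
  current leaves (`HomotopySphereClass.natCard_bP_seven_of_hcobordism_theorem`), with Thm. 7.5 and
  Prop. B replaced by Kervaire–Milnor's Lemma 7.3 (hypothesis `h73`, framed surgery) and Milnor's
  Thm. 9.1, the h-cobordism theorem (`isTrivial_of_isHCobordism_of_five_le`).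

This file records the resulting assemblies of spc4.S13, in the shape in which
`natCard_homotopySphereClass_seven_holds` will consume the `_holds` of the leaves once they exist:

* `natCard_homotopySphereClass_seven_of_frontier'` — `|Θ₇| = 28` from the `3 + 8 = 11` named
  facts above;
* `natCard_homotopySphereClass_seven_of_hcobordism_theorem` — `|Θ₇| = 28` GIVEN `π₆(SO(7), 1) = 0`,
  Lemma 4.2, `0 ∈ p(Σ⁷)`, Lemma 7.3, Thm. 9.1 at universe `0`, and the six named facts
  X.2.2/X.3.3, X.3.1, `E₈`-plumbing, §2-additivity, `224 ∣ σ`, `224` occurs;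
* `exists_commGroup_mulEquiv_zmod_of_frontier'` — `Θ₇ ≅ ℤ₂₈` over the eleven leaves, granted the
  cyclicity fact `exists_commGroup_homotopySphereClass_isCyclic_seven` of `HCobordism.lean`.
* `exists_commGroup_mulEquiv_zmod_of_hcobordism_theorem` — `Θ₇ ≅ ℤ₂₈` under connected sum over
  the deepest leaves with NO cyclicity hypothesis: cyclicity is itself a theorem over Lemma 7.3 at
  `n = 7`, Smale's theorem, §2-additivity and `Θ₇ = bP₈`
  (`exists_commGroup_homotopySphereClass_isCyclic_seven_of_boundsContractible`,
  `HomotopySpheresSignatureReduction.lean`).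

So the printed results separating the tree from `natCard_homotopySphereClass_seven_holds` are
exactly: Bott periodicity (`π₆(SO) = 0`), the Pontryagin–Thom Lemma 4.2 and `coker J₇ = 0`
(`π₇ˢ = im J`), framed surgery (Lemma 7.3; Kosinski X.2.2 below the middle dimension), the
h-cobordism theorem (Milnor 1965, Thm. 9.1), additivity of the signature, the Wu-class evenness
X.3.1, Milnor's `E₈`-plumbing, and `σ₂ = 224` (Hirzebruch's `L₂`, Bott periodicity, `j₂ = 240`).

## Second part (appended 2026-08-15): the frontier after the discharge of additivity

Since the first part was written, additivity of `σ` over sums along the boundary has been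
DISCHARGED (`HomotopySphere.add_mem_signatureSet_of_isOrientedConnectedSum_holds`,
`HomotopySpheresSignatureConnectedSumHolds.lean`: Kervaire–Milnor §2, Lemma 2.2 with Addendum, the
boundary connected sum `W_S ♮ W_T` is s-parallelizable and `σ(W_S ♮ W_T) = σ(W_S) + σ(W_T)`), and
`HomotopySpheresBPOrderSignatureDischarge.lean` has reduced Kervaire–Milnor's `8ℤ`
(`exists_mem_signatureSet_iff_eight_dvd`, p. 530) to evenness of the intersection form of the
closed model of EVERY s-parallelizable null-cobordism (Kosinski X.3.1 without its connectivity
hypothesis; unimodularity for every null-cobordism by Lefschetz duality on `(M, bM)`,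
`HomotopySphere.eight_dvd_of_mem_signatureSet_of_isEven`), so that neither Milnor's Prop. B (no
atlas on the closed model is needed) nor Kosinski's X.2.2/X.3.3 (framed surgery below the middle
dimension) is an input any more. The second part records spc4.S13 over the resulting frontier:

* `natCard_homotopySphereClass_seven_of_frontier''` — `|Θ₇| = 28` from **nine** named facts:
  `hB`, `h42`, `hJ` (`Θ₇ = bP₈`); Thm. 7.5 (`h75`), X.2.2/X.3.3 (`hconn`), X.3.1 (`heven`), the
  `E₈`-plumbing (`hΓ`), `224 ∣ σ` (`hdvd`), `224` occurs (`hex`) — additivity fed its discharge,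
  Prop. B gone (`HomotopySphere.exists_mem_signatureSet_iff_eight_dvd_of_four_leaves`, Lefschetz
  duality);
* `natCard_homotopySphereClass_seven_of_isEven` — `|Θ₇| = 28` from **seven** named facts (`hB`,
  `h42`, `hJ`, `h75`, `hΓ`, `hdvd`, `hex`) and evenness for every s-parallelizable null-cobordism,
  stated inline exactly as the hypothesis of `HomotopySphere.eight_dvd_of_mem_signatureSet_of_isEven`
  (it implies the leaf `heven`, `HomotopySphere.isEven_intersectionForm_closedModel_of_forall`):
  X.2.2/X.3.3 gone as well;
* `natCard_homotopySphereClass_seven_of_hcobordism_theorem'` — `|Θ₇| = 28` over the **deepest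
  current leaves**: `π₆(SO(7), 1) = 0` (`hSO`), Lemma 4.2 (`h42`), `0 ∈ p(Σ⁷)` (`hJ`), Lemma 7.3
  as invoked on p. 530 (`h73`), Milnor's Thm. 9.1 at universe `0` (`h91`, only for Smale's
  theorem inside Thm. 7.5 now), evenness (inline), Kosinski's printed `Γ₈` datum for Milnor's
  plumbing (inline, the hypothesis of `HomotopySphere.exists_intersectionForm_equivalent_e8Form_of_gamma8'`),
  `224 ∣ σ` and `224` occurs;
* `exists_commGroup_mulEquiv_zmod_of_frontier''`, `exists_commGroup_mulEquiv_zmod_of_hcobordism_theorem'`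
  — the corresponding forms of `Θ₇ ≅ ℤ₂₈`, the second with NO cyclicity hypothesis (cyclicity
  from Lemma 7.3 at `n = 7`, Smale's theorem, the discharged additivity and `Θ₇ = bP₈`,
  `exists_commGroup_homotopySphereClass_isCyclic_seven_of_boundsContractible`).

So the printed results now separating the tree from `natCard_homotopySphereClass_seven_holds` are
exactly: Bott periodicity (`π₆(SO(7)) = 0`), the Pontryagin–Thom Lemma 4.2, `coker J₇ = 0`,
framed surgery (Lemma 7.3, with Thm. 5.5 below and Thm. 6.6 in the middle dimension), the
h-cobordism theorem (Thm. 9.1), Wu-class evenness (X.3.1), Milnor's plumbing with intersection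
matrix `Γ₈` (Kosinski VI.12, IX.7.5), and `σ₂ = 224` (Hirzebruch's `L₂`, Bott integrality,
`j₂ = 240`). Everything in the second part is **proved**; no definition, no named fact, no
statement is added or changed (net debt `0`).

## References

* M. Kervaire, J. Milnor, *Groups of homotopy spheres I*, Ann. of Math. 77 (1963), 504–537:
  Thm. 1.2 and table p. 504 (`Θ₇ : 28`); §3, Thm. 3.1 (p. 508), Lemma 3.3 (p. 509); §4,
  pp. 510–512 (definition of `bPₙ₊₁`, Thm. 4.1, Lemma 4.2, Lemma 4.5, table p. 512:
  `Θ₇/bP₈ = 0`); §7: Lemma 7.3 (p. 528), Thm. 7.5 (pp. 529–530), Cor. 7.6 and Discussion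
  (pp. 530–531). doi:10.2307/1970128 [KervaireMilnorAnnals1963]
* A. Kosinski, *Differential Manifolds*, Academic Press (1993), VIII (5.5)–(5.6); Ch. X §2 (2.2),
  §3 (3.1)–(3.4), §6 Prop. 6.2(a) (p. 216), p. 217 (`bP⁸ = ℤ₂₈`), (6.6) and p. 219
  (`θ⁷ = ℤ₂₈`); VI.12; IX.7.5, IX.8.7. [Kosinski1993]
* J. Milnor, *Lectures on the h-cobordism theorem*, Princeton (1965), Thm. 9.1 (p. 107), §9
  Prop. B and Corollary (p. 109). [MilnorHCobordism1965]
* R. Bott, *The stable homotopy of the classical groups*, Ann. of Math. 70 (1959), §1, Corollary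
  to Thm. II, (1.5) (`π₆(O) = 0`). [Bott1959]
-/

open scoped Manifold ContDiff Topology
open Literature.AlgebraicTopology.SingularHomology (HomologicalOrientation)

noncomputable section

namespace Literature.Topology.FourManifolds

/-- **`|Θ₇| = 28` over the current frontier of named facts (`3 + 8 = 11` leaves).** spc4.S13
(`natCard_homotopySphereClass_seven`) from its two conjuncts over their current leaves:
`Θ₇ = bP₈` from Bott's `π₆(SO(8)) = 0` in extension form (`hB`), Kervaire–Milnor's Lemma 4.2 in
the Pontryagin–Thom direction (`h42`) and `0 ∈ p(Σ⁷)`, i.e. `coker J₇ = 0` (`hJ`)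
(`HomotopySphere.boundsParallelizable_seven_of_leaves`); and `|bP₈| = 28` from Kervaire–Milnor's
Thm. 7.5 (`h75`), Kosinski's X.2.2/X.3.3 (`hconn`) and X.3.1 (`heven`), Milnor's `E₈`-plumbing
(`hΓ`), Milnor's Prop. B (`hPB`), additivity of `σ` over sums along the boundary (`hadd`),
`224 ∣ σ(M)` for the s-parallelizable `M⁸` bounded by `S⁷` (`hdvd`) and `σ(M) = 224` occurs
(`hex`) (`HomotopySphereClass.natCard_bP_seven_of_frontier'`); glued by
`natCard_homotopySphereClass_seven_of_bP`. The discharge `natCard_homotopySphereClass_seven_holds`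
is this theorem applied to the eleven `_holds`. Kervaire–Milnor 1963, Thm. 1.2 and table p. 504
(`Θ₇ : 28`), with Thm. 3.1, §4 (Lemmas 4.2, 4.5, table p. 512: `Θ₇/bP₈ = 0`) and §7 (Thm. 7.5,
Cor. 7.6, pp. 530–531: `bP₈` cyclic of order `σ₂/8 = 28`); Kosinski 1993, Ch. X §6, Prop. 6.2(a),
p. 217 and p. 219 ("Since Coker `J₇ = 0`, … `θ⁷ = ℤ₂₈`"), `θ⁷` being identified with the
oriented diffeomorphism classes for `m ≥ 5` (VIII (5.5)–(5.6)). [cite: KervaireMilnorAnnals1963, Thm. 1.2 and table p. 504; Thm. 3.1 (p. 508); §4, Lemma 4.2, Lemma 4.5 and table p. 512; §7, Thm. 7.5, Cor. 7.6 and Discussion pp. 530–531] [cite: Kosinski1993, Ch. X §6, Prop. 6.2(a) (p. 216), p. 217 (bP⁸ = ℤ₂₈), (6.6) and p. 219 (θ⁷ = ℤ₂₈), with VIII (5.5)–(5.6)] -/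
theorem natCard_homotopySphereClass_seven_of_frontier'
    (hB : Bott1959_sphereMapsToStableFramesExtend_six)
    (h42 : boundsParallelizable_of_collapseNullHomotopic)
    (hJ : HomotopySphere.exists_collapseNullHomotopic_seven)
    (h75 : HomotopySphere.mk_eq_mk_iff_sigmaGen_dvd_sub)
    (hconn : HomotopySphere.exists_highlyConnected_of_mem_signatureSet)
    (heven : HomotopySphere.isEven_intersectionForm_closedModel)
    (hΓ : HomotopySphere.exists_intersectionForm_equivalent_e8Form)
    (hPB : nonempty_homeomorph_sphere_of_homologySphere_of_five_le.{0})
    (hadd : HomotopySphere.add_mem_signatureSet_of_isOrientedConnectedSum)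
    (hdvd : HomotopySphere.twoHundredTwentyFour_dvd_of_mem_signatureSet_sphere)
    (hex : HomotopySphere.exists_twoHundredTwentyFour_mem_signatureSet_sphere) :
    natCard_homotopySphereClass_seven :=
  natCard_homotopySphereClass_seven_of_bP (HomotopySphere.boundsParallelizable_seven_of_leaves hB h42 hJ)
    (HomotopySphereClass.natCard_bP_seven_of_frontier' h75 hconn heven hΓ hPB hadd hdvd hex)

/-- **`|Θ₇| = 28` from `π₆(SO(7)) = 0`, the Pontryagin–Thom Lemma 4.2, `coker J₇ = 0`,
Kervaire–Milnor's Lemma 7.3, the h-cobordism theorem and six named facts** — the assembly over the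
deepest current leaves of the tree. GIVEN: (`hSO`) `π₆(SO(7), 1) = 0` (Bott 1959; it gives Bott's
fact in extension form, `Bott1959_sphereMapsToStableFramesExtend_six_of_specialOrthogonalGroup_seven`,
as `π₆(SO(7)) → π₆(SO(8))` is onto); (`h42`) Lemma 4.2; (`hJ`) `0 ∈ p(Σ⁷)`; (`h73`) Lemma 7.3 in
the form in which the proof of Thm. 7.5 invokes it (p. 530: for `n + 1 = 4m`, `m > 1`, a homotopy
`n`-sphere `Σ = bM` with `M` compact s-parallelizable and `σ(M) = 0`, for some homological
orientation of the closed model `M ∪ cone(bM)`, bounds a contractible manifold); (`h91`) Milnor's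
Thm. 9.1, the h-cobordism theorem, at universe `0` (`isTrivial_of_isHCobordism_of_five_le`); and
the named facts X.2.2/X.3.3 (`hconn`), X.3.1 (`heven`), the `E₈`-plumbing (`hΓ`), §2-additivity
(`hadd`), `224 ∣ σ` (`hdvd`) and `224` occurs (`hex`) — then `Nat.card (HomotopySphereClass 7) = 28`.
Proof: `Θ₇ = bP₈` by `HomotopySphere.boundsParallelizable_seven_of_leaves`; `|bP₈| = 28` by
`HomotopySphereClass.natCard_bP_seven_of_hcobordism_theorem` (Thm. 7.5 from `h73`, Smale's theorem
and `hadd`; Prop. B from Thm. 9.1); then `natCard_homotopySphereClass_seven_of_bP`.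
[cite: KervaireMilnorAnnals1963, table p. 504; Thm. 3.1 (p. 508); §4, Lemmas 4.2, 4.5, table p. 512; §7, Lemma 7.3 (p. 528), Thm. 7.5 (pp. 529–530), Cor. 7.6 and Discussion pp. 530–531] [cite: MilnorHCobordism1965, Thm. 9.1 (p. 107) and §9 Prop. B (p. 109)] [cite: Bott1959, §1, Corollary to Thm. II, (1.5)] [cite: Kosinski1993, Ch. X §6, Prop. 6.2(a), p. 217 and p. 219] -/
theorem natCard_homotopySphereClass_seven_of_hcobordism_theorem
    (hSO : Subsingleton (π_ 6 (Matrix.specialOrthogonalGroup (Fin 7) ℝ) 1))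
    (h42 : boundsParallelizable_of_collapseNullHomotopic)
    (hJ : HomotopySphere.exists_collapseNullHomotopic_seven)
    (h73 : ∀ (n m : ℕ) (h : n + 1 = 4 * m), 1 < m →
      ∀ (S : HomotopySphere n) (c : NullCobordism n S.carrier)
        (μ' : HomologicalOrientation ℤ (ClosedModel n c.W) (n + 1)),
        IsStablyParallelizable (𝓡∂ (n + 1)) c.W →
          μ'.signatureInDim (show 2 * m + 2 * m = n + 1 by omega) = 0 →
            BoundsContractible n S.carrier)
    (h91 : isTrivial_of_isHCobordism_of_five_le.{0})
    (hconn : HomotopySphere.exists_highlyConnected_of_mem_signatureSet)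
    (heven : HomotopySphere.isEven_intersectionForm_closedModel)
    (hΓ : HomotopySphere.exists_intersectionForm_equivalent_e8Form)
    (hadd : HomotopySphere.add_mem_signatureSet_of_isOrientedConnectedSum)
    (hdvd : HomotopySphere.twoHundredTwentyFour_dvd_of_mem_signatureSet_sphere)
    (hex : HomotopySphere.exists_twoHundredTwentyFour_mem_signatureSet_sphere) :
    natCard_homotopySphereClass_seven :=
  natCard_homotopySphereClass_seven_of_bP
    (HomotopySphere.boundsParallelizable_seven_of_leaves
      (Bott1959_sphereMapsToStableFramesExtend_six_of_specialOrthogonalGroup_seven hSO) h42 hJ)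
    (HomotopySphereClass.natCard_bP_seven_of_hcobordism_theorem h73 h91 hconn heven hΓ hadd hdvd
      hex)

/-- **`Θ₇ ≅ ℤ₂₈` over the current frontier (`11` leaves)**, granted the cyclicity fact
`exists_commGroup_homotopySphereClass_isCyclic_seven` of `HCobordism.lean`: the group structure on
`Θ₇` whose multiplication is the connected sum is isomorphic to `ℤ/28`
(`exists_commGroup_mulEquiv_zmod_of`, `HomotopySpheresBPOrder.lean`, with
`natCard_homotopySphereClass_seven_of_frontier'`). Kervaire–Milnor 1963, Thm. 1.1–1.2 and table
p. 504; Kosinski 1993, Ch. X §6, p. 219 ("`θ⁷ = ℤ₂₈`"). [cite: KervaireMilnorAnnals1963, Thm. 1.1–1.2 and table p. 504] [cite: Kosinski1993, Ch. X §6, p. 219 (θ⁷ = ℤ₂₈)] -/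
theorem exists_commGroup_mulEquiv_zmod_of_frontier'
    (h₀ : exists_commGroup_homotopySphereClass_isCyclic_seven)
    (hB : Bott1959_sphereMapsToStableFramesExtend_six)
    (h42 : boundsParallelizable_of_collapseNullHomotopic)
    (hJ : HomotopySphere.exists_collapseNullHomotopic_seven)
    (h75 : HomotopySphere.mk_eq_mk_iff_sigmaGen_dvd_sub)
    (hconn : HomotopySphere.exists_highlyConnected_of_mem_signatureSet)
    (heven : HomotopySphere.isEven_intersectionForm_closedModel)
    (hΓ : HomotopySphere.exists_intersectionForm_equivalent_e8Form)
    (hPB : nonempty_homeomorph_sphere_of_homologySphere_of_five_le.{0})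
    (hadd : HomotopySphere.add_mem_signatureSet_of_isOrientedConnectedSum)
    (hdvd : HomotopySphere.twoHundredTwentyFour_dvd_of_mem_signatureSet_sphere)
    (hex : HomotopySphere.exists_twoHundredTwentyFour_mem_signatureSet_sphere) :
    ∃ _ : CommGroup (HomotopySphereClass 7),
      (∀ a b c : HomotopySphereClass 7, HomotopySphereClass.IsMul a b c → a * b = c) ∧
        Nonempty (HomotopySphereClass 7 ≃* Multiplicative (ZMod 28)) :=
  exists_commGroup_mulEquiv_zmod_of h₀
    (natCard_homotopySphereClass_seven_of_frontier' hB h42 hJ h75 hconn heven hΓ hPB hadd hdvd hex)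

/-- **`Θ₇ ≅ ℤ₂₈` under connected sum, over the deepest current leaves — no cyclicity hypothesis.**
GIVEN `π₆(SO(7), 1) = 0` (`hSO`), Kervaire–Milnor's Lemma 4.2 (`h42`), `0 ∈ p(Σ⁷)` (`hJ`),
Lemma 7.3 as invoked on p. 530 (`h73`), Milnor's Thm. 9.1 at universe `0` (`h91`) and the named
facts X.2.2/X.3.3 (`hconn`), X.3.1 (`heven`), the `E₈`-plumbing (`hΓ`), §2-additivity (`hadd`),
`224 ∣ σ` (`hdvd`) and `224` occurs (`hex`): there is a commutative group structure on `Θ₇` whose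
multiplication is the connected sum (`HomotopySphereClass.IsMul`) and a group isomorphism
`Θ₇ ≃* ℤ/28`. The cyclicity of `Θ₇` (the `HCobordism.lean` fact
`exists_commGroup_homotopySphereClass_isCyclic_seven`, Kervaire–Milnor Thm. 1.1 with Cor. 7.6 at
`m = 2`: `Θ₇ = bP₈ ↪ ℤ/σ₂`) is itself a theorem over a sub-frontier
(`exists_commGroup_homotopySphereClass_isCyclic_seven_of_boundsContractible`,
`HomotopySpheresSignatureReduction.lean`: Lemma 7.3 at `n = 7`, Smale's theorem, §2-additivity,
the discharged comparison `HomotopySphere.nonempty_signatureSet_of_boundsParallelizable_holds` and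
`Θ₇ = bP₈`), Smale's theorem being Thm. 9.1 with the proved
`Cobordism.nonempty_diffeomorph_of_isTrivial_holds`, and `Θ₇ = bP₈` the three leaves `hSO`, `h42`,
`hJ` (`HomotopySphere.boundsParallelizable_seven_of_leaves`); the order is
`natCard_homotopySphereClass_seven_of_hcobordism_theorem`; glue `exists_commGroup_mulEquiv_zmod_of`.
Kervaire–Milnor 1963, Thm. 1.1–1.2 and table p. 504 (`Θ₇ ≅ ℤ₂₈`); Kosinski 1993, Ch. X §6, p. 219
("`θ⁷ = ℤ₂₈`"). [cite: KervaireMilnorAnnals1963, Thm. 1.1–1.2 and table p. 504; Cor. 7.6 (p. 530) at m = 2; Lemma 7.3 (p. 528); §4 table p. 512; Remark p. 505] [cite: MilnorHCobordism1965, Thm. 9.1 (p. 107)] [cite: Kosinski1993, Ch. X §6, p. 219 (θ⁷ = ℤ₂₈)] -/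
theorem exists_commGroup_mulEquiv_zmod_of_hcobordism_theorem
    (hSO : Subsingleton (π_ 6 (Matrix.specialOrthogonalGroup (Fin 7) ℝ) 1))
    (h42 : boundsParallelizable_of_collapseNullHomotopic)
    (hJ : HomotopySphere.exists_collapseNullHomotopic_seven)
    (h73 : ∀ (n m : ℕ) (h : n + 1 = 4 * m), 1 < m →
      ∀ (S : HomotopySphere n) (c : NullCobordism n S.carrier)
        (μ' : HomologicalOrientation ℤ (ClosedModel n c.W) (n + 1)),
        IsStablyParallelizable (𝓡∂ (n + 1)) c.W →
          μ'.signatureInDim (show 2 * m + 2 * m = n + 1 by omega) = 0 →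
            BoundsContractible n S.carrier)
    (h91 : isTrivial_of_isHCobordism_of_five_le.{0})
    (hconn : HomotopySphere.exists_highlyConnected_of_mem_signatureSet)
    (heven : HomotopySphere.isEven_intersectionForm_closedModel)
    (hΓ : HomotopySphere.exists_intersectionForm_equivalent_e8Form)
    (hadd : HomotopySphere.add_mem_signatureSet_of_isOrientedConnectedSum)
    (hdvd : HomotopySphere.twoHundredTwentyFour_dvd_of_mem_signatureSet_sphere)
    (hex : HomotopySphere.exists_twoHundredTwentyFour_mem_signatureSet_sphere) :
    ∃ _ : CommGroup (HomotopySphereClass 7),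
      (∀ a b c : HomotopySphereClass 7, HomotopySphereClass.IsMul a b c → a * b = c) ∧
        Nonempty (HomotopySphereClass 7 ≃* Multiplicative (ZMod 28)) := by
  -- Smale's theorem (spc4.S15) from Milnor's Thm. 9.1 and the proved product-cobordism lemma
  have hcob : nonempty_diffeomorph_of_isHCobordant_of_five_le.{0} :=
    nonempty_diffeomorph_of_isHCobordant_of_five_le_of_isTrivial.{0} h91
      (fun {_ _ _} _ _ _ _ => Cobordism.nonempty_diffeomorph_of_isTrivial_holds)
  -- `Θ₇ = bP₈` from its three leaves
  have hB : HomotopySphere.boundsParallelizable_seven :=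
    HomotopySphere.boundsParallelizable_seven_of_leaves
      (Bott1959_sphereMapsToStableFramesExtend_six_of_specialOrthogonalGroup_seven hSO) h42 hJ
  exact exists_commGroup_mulEquiv_zmod_of
    (exists_commGroup_homotopySphereClass_isCyclic_seven_of_boundsContractible
      (fun _ h S h0 => HomotopySphere.boundsContractible_of_zero_mem_signatureSet_of_lemma73
        (h73 7 2 h (by norm_num)) S h0)
      hcob hadd HomotopySphere.nonempty_signatureSet_of_boundsParallelizable_holds hB)
    (natCard_homotopySphereClass_seven_of_hcobordism_theorem hSO h42 hJ h73 h91 hconn heven hΓ hadd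
      hdvd hex)


/-! ## Second part: the frontier after the discharge of additivity (2026-08-15)

Additivity of `σ` over sums along the boundary is now the theorem
`HomotopySphere.add_mem_signatureSet_of_isOrientedConnectedSum_holds`
(`HomotopySpheresSignatureConnectedSumHolds.lean`), and Kervaire–Milnor's `8ℤ` no longer needs an
atlas on the closed model (Lefschetz duality on `(M, bM)`,
`HomotopySphere.exists_mem_signatureSet_iff_eight_dvd_of_four_leaves`) nor, given evenness for every
s-parallelizable null-cobordism, Kosinski's X.2.2
(`HomotopySphere.exists_mem_signatureSet_iff_eight_dvd_of_eight_dvd_of_gamma8` with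
`HomotopySphere.eight_dvd_of_mem_signatureSet_of_isEven`). The assemblies below feed these in; the
glue is `natCard_homotopySphereClass_seven_of_signature` (`HomotopySpheresBPOrderProofs.lean`:
`Θ₇ = bP₈`, Thm. 7.5, the two comparisons — both discharged,
`HomotopySphere.nonempty_signatureSet_of_boundsParallelizable_holds`,
`HomotopySphere.boundsParallelizable_of_mem_signatureSet_holds` — `8ℤ` and `σ₂ = 224`), the
generator convention being the theorem `isOrientableOver_int_euclideanSpace 7`. -/

section AfterAdditivity

open Literature.AlgebraicTopology.SingularHomology

/-- **`|Θ₇| = 28` over the frontier of named facts after the discharge of additivity (`9`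
leaves).** spc4.S13 (`natCard_homotopySphereClass_seven`) from: Bott's `π₆(SO(8)) = 0` in
extension form (`hB`), Kervaire–Milnor's Lemma 4.2 in the Pontryagin–Thom direction (`h42`) and
`0 ∈ p(Σ⁷)`, i.e. `coker J₇ = 0` (`hJ`) — together `Θ₇ = bP₈`
(`HomotopySphere.boundsParallelizable_seven_of_leaves`); Kervaire–Milnor's Thm. 7.5 (`h75`);
Kosinski's X.2.2/X.3.3 (`hconn`) and X.3.1 (`heven`) and Milnor's `E₈`-plumbing (`hΓ`), which with
the DISCHARGED additivity (`HomotopySphere.add_mem_signatureSet_of_isOrientedConnectedSum_holds`)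
give the realised signatures `8ℤ` WITHOUT Milnor's Prop. B
(`HomotopySphere.exists_mem_signatureSet_iff_eight_dvd_of_four_leaves`: unimodularity by Lefschetz
duality on `(M, bM)`, Kervaire–Milnor p. 528 with footnote pp. 528–529); and the two halves of
`σ₂ = 224` (`hdvd`, `hex`; `HomotopySphere.sigmaGen_two_of`). Glue:
`natCard_homotopySphereClass_seven_of_signature`, with the two comparison facts discharged
(`HomotopySphere.nonempty_signatureSet_of_boundsParallelizable_holds`,
`HomotopySphere.boundsParallelizable_of_mem_signatureSet_holds`) and the generator convention
`isOrientableOver_int_euclideanSpace 7`. Compared with `natCard_homotopySphereClass_seven_of_frontier'`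
(`11` leaves), additivity (`hadd`) and Prop. B (`hPB`) are gone. Kervaire–Milnor 1963, Thm. 1.2
and table p. 504 (`Θ₇ : 28`), with Thm. 3.1, §4 (Lemmas 4.2, 4.5, table p. 512: `Θ₇/bP₈ = 0`)
and §7 (Thm. 7.5, Cor. 7.6, pp. 528–531: `bP₈` cyclic of order `σ₂/8 = 28`); Kosinski 1993,
Ch. X §6, Prop. 6.2(a), p. 217 and p. 219 ("Since Coker `J₇ = 0`, … `θ⁷ = ℤ₂₈`").
[cite: KervaireMilnorAnnals1963, Thm. 1.2 and table p. 504; Thm. 3.1 (p. 508); §4, Lemma 4.2, Lemma 4.5 and table p. 512; §7, p. 528 with footnote pp. 528–529, Thm. 7.5, Cor. 7.6 and Discussion pp. 530–531] [cite: Kosinski1993, Ch. X §6, Prop. 6.2(a) (p. 216), p. 217 (bP⁸ = ℤ₂₈), (6.6) and p. 219 (θ⁷ = ℤ₂₈)] -/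
theorem natCard_homotopySphereClass_seven_of_frontier''
    (hB : Bott1959_sphereMapsToStableFramesExtend_six)
    (h42 : boundsParallelizable_of_collapseNullHomotopic)
    (hJ : HomotopySphere.exists_collapseNullHomotopic_seven)
    (h75 : HomotopySphere.mk_eq_mk_iff_sigmaGen_dvd_sub)
    (hconn : HomotopySphere.exists_highlyConnected_of_mem_signatureSet)
    (heven : HomotopySphere.isEven_intersectionForm_closedModel)
    (hΓ : HomotopySphere.exists_intersectionForm_equivalent_e8Form)
    (hdvd : HomotopySphere.twoHundredTwentyFour_dvd_of_mem_signatureSet_sphere)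
    (hex : HomotopySphere.exists_twoHundredTwentyFour_mem_signatureSet_sphere) :
    natCard_homotopySphereClass_seven := by
  obtain ⟨g⟩ := isOrientableOver_int_euclideanSpace 7
  exact natCard_homotopySphereClass_seven_of_signature g
    (HomotopySphere.boundsParallelizable_seven_of_leaves hB h42 hJ) h75
    HomotopySphere.nonempty_signatureSet_of_boundsParallelizable_holds
    HomotopySphere.boundsParallelizable_of_mem_signatureSet_holds
    (HomotopySphere.exists_mem_signatureSet_iff_eight_dvd_of_four_leaves hconn heven hΓ
      HomotopySphere.add_mem_signatureSet_of_isOrientedConnectedSum_holds)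
    (HomotopySphere.sigmaGen_two_of hdvd hex)

/-- **`|Θ₇| = 28` from seven named facts and evenness — no X.2.2, no Prop. B, no additivity
hypothesis.** spc4.S13 from: `hB`, `h42`, `hJ` (`Θ₇ = bP₈`); Thm. 7.5 (`h75`); (`heven`) evenness
of the intersection form `Q(a, b) = ⟨a ⌣ b, [M̂]⟩` of the closed model of EVERY s-parallelizable
null-cobordism `M` of a homotopy `(4m-1)`-sphere, `m > 1`, stated inline exactly as the hypothesis
of the tree theorem `HomotopySphere.eight_dvd_of_mem_signatureSet_of_isEven` (Kosinski 1993,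
X.(3.1): for a `π`-manifold `M²ᵏ`, `k` even, the intersection pairing is even — by Wu's formula
`Sq(v) = w` with `w(M) = 1`, Milnor–Stasheff Thm. 11.14, no connectivity is needed; the hypothesis
implies the leaf `HomotopySphere.isEven_intersectionForm_closedModel`,
`HomotopySphere.isEven_intersectionForm_closedModel_of_forall`, and is deliberately not a named
fact); Milnor's `E₈`-plumbing (`hΓ`); `224 ∣ σ` (`hdvd`) and `224` occurs (`hex`). The realised
signatures `8ℤ` come from `HomotopySphere.exists_mem_signatureSet_iff_eight_dvd_of_eight_dvd_of_gamma8`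
(divisibility by `8` from evenness alone, unimodularity for every null-cobordism by Lefschetz
duality, van der Blij's lemma; "`8` occurs" from `hΓ` and `σ(E₈) = 8`; closure under sums from the
discharged additivity `HomotopySphere.add_mem_signatureSet_of_isOrientedConnectedSum_holds`); the
rest as in `natCard_homotopySphereClass_seven_of_frontier''`. Kervaire–Milnor 1963, Thm. 1.2 and
table p. 504; §4 table p. 512; §7, p. 528, Thm. 7.5, pp. 530–531; Kosinski 1993, Ch. X §6,
Prop. 6.2(a) (p. 216: "the matrix of the intersection pairing is unimodular and even by 3.1"),
p. 217 and p. 219. [cite: KervaireMilnorAnnals1963, Thm. 1.2 and table p. 504; §4 table p. 512; §7, p. 528 with footnote pp. 528–529, Thm. 7.5 and Discussion pp. 530–531] [cite: Kosinski1993, Ch. X, Prop. (3.1) (p. 205) and §6, proof of Prop. 6.2(a) (p. 216), p. 217, p. 219] [cite: MilnorStasheff1974, §11, Thm. 11.14] -/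
theorem natCard_homotopySphereClass_seven_of_isEven
    (hB : Bott1959_sphereMapsToStableFramesExtend_six)
    (h42 : boundsParallelizable_of_collapseNullHomotopic)
    (hJ : HomotopySphere.exists_collapseNullHomotopic_seven)
    (h75 : HomotopySphere.mk_eq_mk_iff_sigmaGen_dvd_sub)
    (heven : ∀ (n m : ℕ) (h : n + 1 = 4 * m), 1 < m →
      ∀ (S : HomotopySphere n) (c : NullCobordism n S.carrier)
        (μ' : HomologicalOrientation ℤ (ClosedModel n c.W) (n + 1)),
        IsStablyParallelizable (𝓡∂ (n + 1)) c.W →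
          (intersectionForm (show 2 * m + 2 * m = n + 1 by omega) μ').IsEven)
    (hΓ : HomotopySphere.exists_intersectionForm_equivalent_e8Form)
    (hdvd : HomotopySphere.twoHundredTwentyFour_dvd_of_mem_signatureSet_sphere)
    (hex : HomotopySphere.exists_twoHundredTwentyFour_mem_signatureSet_sphere) :
    natCard_homotopySphereClass_seven := by
  obtain ⟨g⟩ := isOrientableOver_int_euclideanSpace 7
  exact natCard_homotopySphereClass_seven_of_signature g
    (HomotopySphere.boundsParallelizable_seven_of_leaves hB h42 hJ) h75
    HomotopySphere.nonempty_signatureSet_of_boundsParallelizable_holds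
    HomotopySphere.boundsParallelizable_of_mem_signatureSet_holds
    (HomotopySphere.exists_mem_signatureSet_iff_eight_dvd_of_eight_dvd_of_gamma8
      (HomotopySphere.eight_dvd_of_mem_signatureSet_of_isEven heven) hΓ
      HomotopySphere.add_mem_signatureSet_of_isOrientedConnectedSum_holds)
    (HomotopySphere.sigmaGen_two_of hdvd hex)

/-- **`|Θ₇| = 28` over the deepest current leaves of the tree (after the discharge of
additivity).** GIVEN: (`hSO`) `π₆(SO(7), 1) = 0` (Bott 1959; it gives Bott's fact in extension
form, `Bott1959_sphereMapsToStableFramesExtend_six_of_specialOrthogonalGroup_seven`); (`h42`)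
Kervaire–Milnor's Lemma 4.2; (`hJ`) `0 ∈ p(Σ⁷)` (`coker J₇ = 0`); (`h73`) Lemma 7.3 in the form in
which the proof of Thm. 7.5 invokes it (p. 530: for `n + 1 = 4m`, `m > 1`, a homotopy `n`-sphere
`Σ = bM` with `M` compact s-parallelizable and `σ(M) = 0`, for some homological orientation of the
closed model, bounds a contractible manifold; Lemma 7.3 p. 528 with Thm. 6.6 p. 526); (`h91`)
Milnor's Thm. 9.1, the h-cobordism theorem, at universe `0` (`isTrivial_of_isHCobordism_of_five_le`)
— now used ONLY for Smale's theorem inside Thm. 7.5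
(`HomotopySphere.mk_eq_mk_iff_sigmaGen_dvd_sub_of_lemma73`), Prop. B having dropped out;
(`heven`) evenness for every s-parallelizable null-cobordism (Kosinski X.(3.1), inline as in
`natCard_homotopySphereClass_seven_of_isEven`); (`hΓ`) Kosinski's printed datum for Milnor's
plumbing `M(4m)` (VI.12, p. 122: an s-parallelizable null-cobordism of some homotopy sphere with a
basis of `H²ᵐ(M̂; ℤ)/T` whose Gram matrix is `Γ₈` up to the signs of the off-diagonal entries;
(12.2), IX.(7.5)), inline exactly as the hypothesis of the tree theorem
`HomotopySphere.exists_intersectionForm_equivalent_e8Form_of_gamma8'`; (`hdvd`) `224 ∣ σ(M₀)` for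
`bM₀ = S⁷`; (`hex`) `224` occurs. THEN `Nat.card (HomotopySphereClass 7) = 28`. Proof:
`Θ₇ = bP₈` by `HomotopySphere.boundsParallelizable_seven_of_leaves`; Thm. 7.5 from `h73`, Smale's
theorem (Thm. 9.1 with the proved `Cobordism.nonempty_diffeomorph_of_isTrivial_holds`) and the
discharged additivity; `8ℤ` by `HomotopySphere.exists_mem_signatureSet_iff_eight_dvd_of_isEven_of_gamma8`;
`σ₂ = 224` by `HomotopySphere.sigmaGen_two_of`; glue `natCard_homotopySphereClass_seven_of_signature`.
[cite: KervaireMilnorAnnals1963, Thm. 1.2 and table p. 504; Thm. 3.1 (p. 508); §4, Lemmas 4.2, 4.5, table p. 512; §7, Lemma 7.3 (p. 528), Thm. 7.5 (pp. 529–530), Cor. 7.6 and Discussion pp. 530–531] [cite: MilnorHCobordism1965, Thm. 9.1 (p. 107)] [cite: Bott1959, §1, Corollary to Thm. II, (1.5)] [cite: Kosinski1993, Ch. X, Prop. (3.1), §6 Prop. 6.2(a) (p. 216), p. 217 and p. 219; VI.12 (p. 122), IX.(7.5)] [cite: MilnorStasheff1974, §11, Thm. 11.14] -/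
theorem natCard_homotopySphereClass_seven_of_hcobordism_theorem'
    (hSO : Subsingleton (π_ 6 (Matrix.specialOrthogonalGroup (Fin 7) ℝ) 1))
    (h42 : boundsParallelizable_of_collapseNullHomotopic)
    (hJ : HomotopySphere.exists_collapseNullHomotopic_seven)
    (h73 : ∀ (n m : ℕ) (h : n + 1 = 4 * m), 1 < m →
      ∀ (S : HomotopySphere n) (c : NullCobordism n S.carrier)
        (μ' : HomologicalOrientation ℤ (ClosedModel n c.W) (n + 1)),
        IsStablyParallelizable (𝓡∂ (n + 1)) c.W →
          μ'.signatureInDim (show 2 * m + 2 * m = n + 1 by omega) = 0 →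
            BoundsContractible n S.carrier)
    (h91 : isTrivial_of_isHCobordism_of_five_le.{0})
    (heven : ∀ (n m : ℕ) (h : n + 1 = 4 * m), 1 < m →
      ∀ (S : HomotopySphere n) (c : NullCobordism n S.carrier)
        (μ' : HomologicalOrientation ℤ (ClosedModel n c.W) (n + 1)),
        IsStablyParallelizable (𝓡∂ (n + 1)) c.W →
          (intersectionForm (show 2 * m + 2 * m = n + 1 by omega) μ').IsEven)
    (hΓ : ∀ (n m : ℕ) (h : n + 1 = 4 * m), 1 < m →
      ∃ (S : HomotopySphere n) (μ : HomologicalOrientation ℤ S.carrier n)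
        (c : NullCobordism n S.carrier) (μ' : HomologicalOrientation ℤ (ClosedModel n c.W) (n + 1)),
        IsStablyParallelizable (𝓡∂ (n + 1)) c.W ∧ c.IsOrientedBy μ μ' ∧
          ∃ b : Module.Basis (Fin 8) ℤ ↥(freeCohomology ℤ (ClosedModel n c.W) (2 * m)),
            (∀ i, intersectionForm (show 2 * m + 2 * m = n + 1 by omega) μ' (b i) (b i) = 2) ∧
            ∀ i j, i ≠ j →
              |intersectionForm (show 2 * m + 2 * m = n + 1 by omega) μ' (b i) (b j)| =
                kosinskiGamma8 i j)
    (hdvd : HomotopySphere.twoHundredTwentyFour_dvd_of_mem_signatureSet_sphere)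
    (hex : HomotopySphere.exists_twoHundredTwentyFour_mem_signatureSet_sphere) :
    natCard_homotopySphereClass_seven := by
  -- Smale's theorem (spc4.S15) from Milnor's Thm. 9.1 and the proved product-cobordism lemma
  have hcob : nonempty_diffeomorph_of_isHCobordant_of_five_le.{0} :=
    nonempty_diffeomorph_of_isHCobordant_of_five_le_of_isTrivial.{0} h91
      (fun {_ _ _} _ _ _ _ => Cobordism.nonempty_diffeomorph_of_isTrivial_holds)
  obtain ⟨g⟩ := isOrientableOver_int_euclideanSpace 7
  exact natCard_homotopySphereClass_seven_of_signature g
    (HomotopySphere.boundsParallelizable_seven_of_leaves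
      (Bott1959_sphereMapsToStableFramesExtend_six_of_specialOrthogonalGroup_seven hSO) h42 hJ)
    (HomotopySphere.mk_eq_mk_iff_sigmaGen_dvd_sub_of_lemma73 h73 hcob
      HomotopySphere.add_mem_signatureSet_of_isOrientedConnectedSum_holds)
    HomotopySphere.nonempty_signatureSet_of_boundsParallelizable_holds
    HomotopySphere.boundsParallelizable_of_mem_signatureSet_holds
    (HomotopySphere.exists_mem_signatureSet_iff_eight_dvd_of_isEven_of_gamma8 heven hΓ
      HomotopySphere.add_mem_signatureSet_of_isOrientedConnectedSum_holds)
    (HomotopySphere.sigmaGen_two_of hdvd hex)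

/-- **`Θ₇ ≅ ℤ₂₈` over the frontier after the discharge of additivity (`9` leaves)**, granted the
cyclicity fact `exists_commGroup_homotopySphereClass_isCyclic_seven` of `HCobordism.lean`: the
group structure on `Θ₇` whose multiplication is the connected sum is isomorphic to `ℤ/28`
(`exists_commGroup_mulEquiv_zmod_of` with `natCard_homotopySphereClass_seven_of_frontier''`).
Kervaire–Milnor 1963, Thm. 1.1–1.2 and table p. 504; Kosinski 1993, Ch. X §6, p. 219
("`θ⁷ = ℤ₂₈`"). [cite: KervaireMilnorAnnals1963, Thm. 1.1–1.2 and table p. 504] [cite: Kosinski1993, Ch. X §6, p. 219 (θ⁷ = ℤ₂₈)] -/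
theorem exists_commGroup_mulEquiv_zmod_of_frontier''
    (h₀ : exists_commGroup_homotopySphereClass_isCyclic_seven)
    (hB : Bott1959_sphereMapsToStableFramesExtend_six)
    (h42 : boundsParallelizable_of_collapseNullHomotopic)
    (hJ : HomotopySphere.exists_collapseNullHomotopic_seven)
    (h75 : HomotopySphere.mk_eq_mk_iff_sigmaGen_dvd_sub)
    (hconn : HomotopySphere.exists_highlyConnected_of_mem_signatureSet)
    (heven : HomotopySphere.isEven_intersectionForm_closedModel)
    (hΓ : HomotopySphere.exists_intersectionForm_equivalent_e8Form)
    (hdvd : HomotopySphere.twoHundredTwentyFour_dvd_of_mem_signatureSet_sphere)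
    (hex : HomotopySphere.exists_twoHundredTwentyFour_mem_signatureSet_sphere) :
    ∃ _ : CommGroup (HomotopySphereClass 7),
      (∀ a b c : HomotopySphereClass 7, HomotopySphereClass.IsMul a b c → a * b = c) ∧
        Nonempty (HomotopySphereClass 7 ≃* Multiplicative (ZMod 28)) :=
  exists_commGroup_mulEquiv_zmod_of h₀
    (natCard_homotopySphereClass_seven_of_frontier'' hB h42 hJ h75 hconn heven hΓ hdvd hex)

/-- **`Θ₇ ≅ ℤ₂₈` under connected sum, over the deepest current leaves (after the discharge of
additivity) — no cyclicity hypothesis.** GIVEN `π₆(SO(7), 1) = 0` (`hSO`), Lemma 4.2 (`h42`),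
`0 ∈ p(Σ⁷)` (`hJ`), Lemma 7.3 as invoked on p. 530 (`h73`), Milnor's Thm. 9.1 at universe `0`
(`h91`), evenness (`heven`, inline), Kosinski's `Γ₈` datum (`hΓ`, inline), `224 ∣ σ` (`hdvd`) and
`224` occurs (`hex`): there is a commutative group structure on `Θ₇` whose multiplication is the
connected sum and a group isomorphism `Θ₇ ≃* ℤ/28`. Cyclicity (Kervaire–Milnor Thm. 1.1 with
Cor. 7.6 at `m = 2`: `Θ₇ = bP₈ ↪ ℤ/σ₂`) is the theorem
`exists_commGroup_homotopySphereClass_isCyclic_seven_of_boundsContractible` over Lemma 7.3 at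
`n = 7`, Smale's theorem (Thm. 9.1 with `Cobordism.nonempty_diffeomorph_of_isTrivial_holds`), the
discharged additivity and comparison, and `Θ₇ = bP₈` (`hSO`, `h42`, `hJ`); the order is
`natCard_homotopySphereClass_seven_of_hcobordism_theorem'`; glue `exists_commGroup_mulEquiv_zmod_of`.
Kervaire–Milnor 1963, Thm. 1.1–1.2 and table p. 504 (`Θ₇ ≅ ℤ₂₈`); Kosinski 1993, Ch. X §6, p. 219.
[cite: KervaireMilnorAnnals1963, Thm. 1.1–1.2 and table p. 504; Cor. 7.6 (p. 530) at m = 2; Lemma 7.3 (p. 528); §4 table p. 512; Remark p. 505] [cite: MilnorHCobordism1965, Thm. 9.1 (p. 107)] [cite: Kosinski1993, Ch. X §6, p. 219 (θ⁷ = ℤ₂₈)] -/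
theorem exists_commGroup_mulEquiv_zmod_of_hcobordism_theorem'
    (hSO : Subsingleton (π_ 6 (Matrix.specialOrthogonalGroup (Fin 7) ℝ) 1))
    (h42 : boundsParallelizable_of_collapseNullHomotopic)
    (hJ : HomotopySphere.exists_collapseNullHomotopic_seven)
    (h73 : ∀ (n m : ℕ) (h : n + 1 = 4 * m), 1 < m →
      ∀ (S : HomotopySphere n) (c : NullCobordism n S.carrier)
        (μ' : HomologicalOrientation ℤ (ClosedModel n c.W) (n + 1)),
        IsStablyParallelizable (𝓡∂ (n + 1)) c.W →
          μ'.signatureInDim (show 2 * m + 2 * m = n + 1 by omega) = 0 →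
            BoundsContractible n S.carrier)
    (h91 : isTrivial_of_isHCobordism_of_five_le.{0})
    (heven : ∀ (n m : ℕ) (h : n + 1 = 4 * m), 1 < m →
      ∀ (S : HomotopySphere n) (c : NullCobordism n S.carrier)
        (μ' : HomologicalOrientation ℤ (ClosedModel n c.W) (n + 1)),
        IsStablyParallelizable (𝓡∂ (n + 1)) c.W →
          (intersectionForm (show 2 * m + 2 * m = n + 1 by omega) μ').IsEven)
    (hΓ : ∀ (n m : ℕ) (h : n + 1 = 4 * m), 1 < m →
      ∃ (S : HomotopySphere n) (μ : HomologicalOrientation ℤ S.carrier n)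
        (c : NullCobordism n S.carrier) (μ' : HomologicalOrientation ℤ (ClosedModel n c.W) (n + 1)),
        IsStablyParallelizable (𝓡∂ (n + 1)) c.W ∧ c.IsOrientedBy μ μ' ∧
          ∃ b : Module.Basis (Fin 8) ℤ ↥(freeCohomology ℤ (ClosedModel n c.W) (2 * m)),
            (∀ i, intersectionForm (show 2 * m + 2 * m = n + 1 by omega) μ' (b i) (b i) = 2) ∧
            ∀ i j, i ≠ j →
              |intersectionForm (show 2 * m + 2 * m = n + 1 by omega) μ' (b i) (b j)| =
                kosinskiGamma8 i j)
    (hdvd : HomotopySphere.twoHundredTwentyFour_dvd_of_mem_signatureSet_sphere)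
    (hex : HomotopySphere.exists_twoHundredTwentyFour_mem_signatureSet_sphere) :
    ∃ _ : CommGroup (HomotopySphereClass 7),
      (∀ a b c : HomotopySphereClass 7, HomotopySphereClass.IsMul a b c → a * b = c) ∧
        Nonempty (HomotopySphereClass 7 ≃* Multiplicative (ZMod 28)) := by
  -- Smale's theorem (spc4.S15) from Milnor's Thm. 9.1 and the proved product-cobordism lemma
  have hcob : nonempty_diffeomorph_of_isHCobordant_of_five_le.{0} :=
    nonempty_diffeomorph_of_isHCobordant_of_five_le_of_isTrivial.{0} h91
      (fun {_ _ _} _ _ _ _ => Cobordism.nonempty_diffeomorph_of_isTrivial_holds)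
  -- `Θ₇ = bP₈` from its three leaves
  have hB : HomotopySphere.boundsParallelizable_seven :=
    HomotopySphere.boundsParallelizable_seven_of_leaves
      (Bott1959_sphereMapsToStableFramesExtend_six_of_specialOrthogonalGroup_seven hSO) h42 hJ
  exact exists_commGroup_mulEquiv_zmod_of
    (exists_commGroup_homotopySphereClass_isCyclic_seven_of_boundsContractible
      (fun _ h S h0 => HomotopySphere.boundsContractible_of_zero_mem_signatureSet_of_lemma73
        (h73 7 2 h (by norm_num)) S h0)
      hcob HomotopySphere.add_mem_signatureSet_of_isOrientedConnectedSum_holds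
      HomotopySphere.nonempty_signatureSet_of_boundsParallelizable_holds hB)
    (natCard_homotopySphereClass_seven_of_hcobordism_theorem' hSO h42 hJ h73 h91 heven hΓ hdvd hex)

end AfterAdditivity

end Literature.Topology.FourManifolds

end
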